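/-
Copyright (c) 2026 the pub-hodgecm-mathlib formalisation cell (harness21).  Prover seat hodgecm-mathlib-K2Liu-p25 (g2), Track B «K2-LIT» ∕ hLiu418
#184♮ = `stmt-HodgeConjecture-24832`, Road Φ ∕ socket #41, organ G5 (u-0c): the I3-SIDE LETTER «standard section ⇒ finite `K_H`-type of the inner
section» — the by-value inputs `c M G hcM hF hG` (+ continuity, sup bounds and the level of `c`) of ★ I3 `K2LiuSiegelMiddleTermKTypes.exists_KTypes_package`
(desk K2E5-p17 (g8) «=» 2026-09-04T16:45:18Z; consumer = the (u-0c) I4 instance, ED. 3+).  THEOREMS ONLY (no `def`, no instance, no notation, no `sorry`).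
-/
import Literature.NumberTheory.K2Lit.SiegelStandardSections                            -- ★ `IwasawaDatum`, `rightTranslateSpan`, `IsStandardSectionFamily(.apply_delta_mul)`
import Literature.NumberTheory.Automorphic.HarishChandraFinitenessGLIdealOfCharacter     -- ★ `exists_finsupp_eval_eq` (coordinate functionals = finite sums of evaluations)
import Mathlib.MeasureTheory.Integral.Bochner.Basic
import HarnessLib

/-!
# Crux `HLiu418`, Road Φ, organ G5 (u-0c): A STANDARD SECTION FAMILY GIVES THE INNER SECTION A FINITE `K_H`-TYPE — the by-value inputs
# `c M G hcM hF hG` of ★ I3 `K2LiuSiegelMiddleTermKTypes.exists_KTypes_package`, from `IsStandardSectionFamily 𝒦 χ f`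

Cell `hodgecm-mathlib`, crux item hLiu418 = `stmt-HodgeConjecture-24832`; squad K2 ∕ K2Liu (L1, LEAD F0P6-plan (g14)); prover K2Liu-p25 (g2).  THEOREMS ONLY;
lane `--supports stmt-HodgeConjecture-24832 --as helper`.

WHY.  ★ I3 `exists_KTypes_package` (the `W`-package + `hφW`, `hφbd` of the untwisted inner family `φ s x g = a g · b x · F s (Λ g · k_x)` of the #41 middle term)
takes BY VALUE a FINITE `K_H`-TYPE of the inner section `F`: an index type `ι`, coefficient functions `c_j : H(𝔸) → ℂ` with the MATRIX-COEFFICIENT LAW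
`c_j(h·k₁) = Σ_l M_{jl}(k₁) · c_l(h)` (ALL `h ∈ H(𝔸)`, `k₁ ∈ K_H`), scalar families `G_j` continuous on `{0 < re}`, and `F s h = Σ_j c_j(h) · G_j(s)` on `K_H`
(`0 < re s`), together with continuity, sup bounds and the level of the `c_j`.  THIS FILE pays that input from «`f` is STANDARD» (Literature
`IsStandardSectionFamily 𝒦 χ f`: holomorphic Siegel sections, `K_H`-finite at every `s`, FLAT on `K_H = 𝒦.K`), hypothesis-first over the inner section
`F s y = ∫ (β u).toReal • f s (w₀ · (a u · y)) dν` (at the datum: `ν = νN`, `β = β₁`, `a = (↑)` on `N_Δ(𝔸)`, ★ `K2LiuSiegelMiddleTermIdentification` §3's `hF` VERBATIM):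
* §1 GENERIC ALGEBRA (any group `G`, subgroup `K`, `ψ : G → ℂ` whose right `K`-translates span a finite-dimensional space): `exists_translate_basis` — a BASIS OF
  TRANSLATES `R(k_j)ψ` (Mathlib `exists_linearIndependent'`) with EXTENDED COORDINATE FUNCTIONALS `ℓ_j` = finite sums of evaluations (★ `exists_finsupp_eval_eq`);
  `exists_KType_coeff` — the generalised matrix coefficients `c j l h := ℓ_j(R(h)R(k_l)ψ) = Σ_x w_j(x) ψ(x·h·k_l)` satisfy the GLOBAL law
  `c j l (h·k₁) = Σ_i c i l k₁ · c j i h` (all `h ∈ G`, `k₁ ∈ K`) and `ψ(g·h) = Σ_{j,l} a_l c j l h · ψ(g·k_j)` (`h ∈ K`, all `g ∈ G`);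
* §2 SECTIONS: `apply_mul_eq_sum_of_standard` — the FLAT DEFORMATION `f_s(g·h) = Σ_{j,l} a_l c j l h · f_s(g·k_j)` for EVERY `s` (`h ∈ K_H`, all `g ∈ H(𝔸)`; Iwasawa
  `H(𝔸) = P_Δ(𝔸)·K_H` + the structure lemma ★ `IsStandardSectionFamily.apply_delta_mul`, no topology); `integrable_toReal_smul_of_dom(_family)` — the (β0-hol)
  majorant letters `hmeas`∕`hdom` give the integrability this file takes by value;
* §3 **`exists_KHType_of_standard`** — OUTPUT in ★ I3's currency: `∃ ι [Fintype ι] c M G` with `hcM` (ALL `h`), `hF` (`0 < re s`, `h ∈ 𝒦.K`), `hG`, `Continuous (c j)` on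
  `H(𝔸)`, `∃ Cc, ‖c j h‖ ≤ Cc` and `∃ CM, ‖M j l k‖ ≤ CM` on `𝒦.K`, and the LEVEL `c j (h·u) = c j h` (`u ∈ U`, `U` normalised by `𝒦.K`, `f s₀` right-`U`-invariant);
  `ι = Fin m × Fin m`, `M` is built from `c` itself (`M (j,l) (j',i) k₁ = [j' = j] · c i l k₁`), `G (j,l) s = a_l · F s k_j`.  I3's `hc_cont`∕`hCc`∕`hc_lev` follow by
  composing with `Λ|_K` and `hΛK : Λ(K) ⊆ 𝒦.K`.
BY VALUE (named): `hint` — integrability of `u ↦ (β u).toReal • f s (w₀·(a u·k))` for `0 < re s`, `k ∈ 𝒦.K` (the (β0-hol) majorant; adapter §2); `hFc` — continuity of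
`s ↦ F s k` on `{0 < re}` (★ (β0-hol) `differentiableOn_innerSection ….continuousOn`); `hfc` — continuity of `f s₀`; the level pair `hUK`, `hfU`.
References: [MoeglinWaldspurger1995, I.2.17, II.1.7, IV.1.9]; [Bump1997, §3.7]; [BorelJacquet1979, §4.1]; [Tan1999, §1]; [HarrisKudlaSweet1996, (1.15)–(1.17)].
HONEST LABEL.  Count-neutral helper: `HC_CM` is proved only modulo the 7 printed citations (2 remaining named inputs: hLiu418 = `stmt-HodgeConjecture-24832`,
h413 = `stmt-HodgeConjecture-24833`) until rung 0 closes; this file closes no socket.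
-/

set_option autoImplicit false
set_option linter.dupNamespace false -- the mandated namespace repeats `HodgeConjecture.HodgeConjecture`

noncomputable section

open MeasureTheory NumberField Set Filter Topology Metric
open scoped ENNReal NNReal
open Literature.NumberTheory.Automorphic Literature.NumberTheory.GaloisRepresentations
open Literature.NumberTheory.GelbartRogawski1991 Literature.NumberTheory.GelbartRogawski1991.GRConstruction
open Literature.NumberTheory.K2Lit.SiegelDoubled

namespace Summit.HodgeConjecture.HodgeConjecture.Cruxes.HLiu418.K2LiuSiegelMiddleTermInnerKTypeOfStandard

/-! ## §1 Generic algebra: a basis of right translates and global matrix coefficients -/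

section Generic

variable {G : Type*} [Group G]

/-- **A BASIS OF RIGHT TRANSLATES WITH EVALUATION COORDINATES.**  If the right `K`-translates `g ↦ ψ(g·k)` (`k ∈ K`) of `ψ : G → ℂ` span a finite-dimensional space `V`,
there are finitely many `k_j ∈ K` and finitely supported weights `w_j : G →₀ ℂ` such that every `v ∈ V` is `v(g) = Σ_j ℓ_j(v) · ψ(g·k_j)` with
`ℓ_j(v) = Σ_x w_j(x) · v(x)` (the translates `R(k_j)ψ` are a basis of `V`, Mathlib `exists_linearIndependent'`; each coordinate functional is a finite sum of
evaluations, ★ `exists_finsupp_eval_eq`). [cite: MoeglinWaldspurger1995, I.2.17] [cite: Bump1997, §3.7] -/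
theorem exists_translate_basis (K : Subgroup G) (ψ : G → ℂ)
    (hfin : FiniteDimensional ℂ (Submodule.span ℂ (Set.range fun k : K => fun g : G => ψ (g * (k : G))))) :
    ∃ (m : ℕ) (kb : Fin m → G) (w : Fin m → (G →₀ ℂ)), (∀ j, kb j ∈ K) ∧
      ∀ v : G → ℂ, v ∈ Submodule.span ℂ (Set.range fun k : K => fun g : G => ψ (g * (k : G))) →
        ∀ g, v g = ∑ j, ((w j).sum fun x t => t * v x) * ψ (g * kb j) := by
  set V : Submodule ℂ (G → ℂ) := Submodule.span ℂ (Set.range fun k : K => fun g : G => ψ (g * (k : G)))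
  haveI : FiniteDimensional ℂ V := hfin
  -- the generators as elements of `V`; they span `V`
  set T : K → V := fun k => ⟨fun g => ψ (g * (k : G)), Submodule.subset_span ⟨k, rfl⟩⟩
  have hTspan : Submodule.span ℂ (Set.range T) = ⊤ := by
    apply Submodule.map_injective_of_injective V.injective_subtype
    rw [Submodule.map_subtype_top, ← Submodule.span_image, ← Set.range_comp]
    rfl
  -- a linearly independent spanning subfamily: finite, reindexed by `Fin m`
  obtain ⟨κ, ia, -, hspan, hli⟩ := exists_linearIndependent' ℂ T
  haveI : Finite κ := hli.finite
  letI : Fintype κ := Fintype.ofFinite κ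
  set b₀ : Module.Basis κ ℂ V := Module.Basis.mk hli (by rw [hspan, hTspan])
  set b : Module.Basis (Fin (Fintype.card κ)) ℂ V := b₀.reindex (Fintype.equivFin κ)
  have hbj : ∀ j g, (b j : G → ℂ) g = ψ (g * ((ia ((Fintype.equivFin κ).symm j) : K) : G)) := by
    intro j g
    rw [Module.Basis.reindex_apply, Module.Basis.mk_apply]
    rfl
  -- extended coordinate functionals
  choose w hw using fun j => exists_finsupp_eval_eq V (b.coord j)
  refine ⟨Fintype.card κ, fun j => ((ia ((Fintype.equivFin κ).symm j) : K) : G), w, fun j => (ia ((Fintype.equivFin κ).symm j)).2,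
    fun v hv g => ?_⟩
  have hsum := congrArg (fun z : V => (z : G → ℂ) g) (b.sum_repr ⟨v, hv⟩)
  simp only [Submodule.coe_sum, Submodule.coe_smul, Finset.sum_apply, Pi.smul_apply, smul_eq_mul] at hsum
  rw [← hsum]
  refine Finset.sum_congr rfl fun j _ => ?_
  rw [hbj j g]
  congr 1
  rw [← Module.Basis.coord_apply]
  exact hw j ⟨v, hv⟩

/-- **GLOBAL MATRIX COEFFICIENTS OF A FINITE `K`-TYPE.**  With the basis of translates `R(k_j)ψ` and evaluation coordinates `ℓ_j` of `exists_translate_basis`, the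
generalised matrix coefficients `c j l h := ℓ_j(R(h) R(k_l) ψ) = Σ_x w_j(x) · ψ(x·h·k_l)` (defined for ALL `h ∈ G`) satisfy the law
`c j l (h·k₁) = Σ_i c i l k₁ · c j i h` for all `h ∈ G`, `k₁ ∈ K`, and the translates of `ψ` by `K` expand as `ψ(g·h) = Σ_j Σ_l a_l · c j l h · ψ(g·k_j)`
(`h ∈ K`, all `g`; `a_l = ℓ_l(ψ)`). [cite: MoeglinWaldspurger1995, I.2.17] [cite: BorelJacquet1979, §4.1] -/
theorem exists_KType_coeff (K : Subgroup G) (ψ : G → ℂ)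
    (hfin : FiniteDimensional ℂ (Submodule.span ℂ (Set.range fun k : K => fun g : G => ψ (g * (k : G))))) :
    ∃ (m : ℕ) (kb : Fin m → G) (w : Fin m → (G →₀ ℂ)) (a : Fin m → ℂ) (c : Fin m → Fin m → G → ℂ),
      (∀ j, kb j ∈ K) ∧
      (∀ j l h, c j l h = (w j).sum fun x t => t * ψ (x * h * kb l)) ∧
      (∀ (j l : Fin m) (h k₁ : G), k₁ ∈ K → c j l (h * k₁) = ∑ i, c i l k₁ * c j i h) ∧
      (∀ h : G, h ∈ K → ∀ g : G, ψ (g * h) = ∑ j, ∑ l, (a l * c j l h) * ψ (g * kb j)) := by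
  obtain ⟨m, kb, w, hkb, hexp⟩ := exists_translate_basis K ψ hfin
  have hmem : ∀ k : G, k ∈ K →
      (fun g : G => ψ (g * k)) ∈ Submodule.span ℂ (Set.range fun k : K => fun g : G => ψ (g * (k : G))) :=
    fun k hk => Submodule.subset_span ⟨⟨k, hk⟩, rfl⟩
  refine ⟨m, kb, w, fun l => (w l).sum fun x t => t * ψ x, fun j l h => (w j).sum fun x t => t * ψ (x * h * kb l), hkb,
    fun _ _ _ => rfl, ?_, ?_⟩
  · -- the law: expand the generator `y ↦ ψ(y·(k₁·k_l))` in the basis and substitute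
    intro j l h k₁ hk₁
    have hE : ∀ x, ψ (x * (h * k₁) * kb l) =
        ∑ i, ((w i).sum fun y t => t * ψ (y * k₁ * kb l)) * ψ (x * h * kb i) := by
      intro x
      have h1 := hexp _ (hmem _ (K.mul_mem hk₁ (hkb l))) (x * h)
      simp only [mul_assoc] at h1 ⊢
      exact h1
    simp only [Finsupp.sum, hE, Finset.mul_sum]
    rw [Finset.sum_comm]
    refine Finset.sum_congr rfl fun i _ => Finset.sum_congr rfl fun x _ => ?_
    ring
  · -- the expansion of the translates of `ψ`
    intro h hh g
    have hψ : ∀ y, ψ y = ∑ l, ((w l).sum fun x t => t * ψ x) * ψ (y * kb l) := by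
      intro y
      have h1 := hexp _ (hmem 1 K.one_mem) y
      simpa only [mul_one] using h1
    rw [hexp _ (hmem h hh) g]
    refine Finset.sum_congr rfl fun j _ => ?_
    have hL : ((w j).sum fun x t => t * ψ (x * h)) = ∑ l, ((w l).sum fun x t => t * ψ x) * (w j).sum fun x t => t * ψ (x * h * kb l) := by
      simp only [Finsupp.sum]
      conv_lhs => arg 2; ext x; rw [hψ (x * h), Finset.mul_sum]
      simp only [Finsupp.sum]
      rw [Finset.sum_comm]
      refine Finset.sum_congr rfl fun l _ => ?_
      rw [Finset.mul_sum]
      refine Finset.sum_congr rfl fun x _ => ?_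
      ring
    rw [hL, Finset.sum_mul]

end Generic

/-! ## §2 Sections: the flat deformation of the `K_H`-type expansion; integrability from a majorant -/

section Integrable

variable {X : Type*} [MeasurableSpace X] {H : Type*}

/-- integrability of `u ↦ (β u).toReal • φ u` from a.e.-strong measurability and an integrable majorant of `(β u).toReal · ‖φ u‖`. [folklore] -/
theorem integrable_toReal_smul_of_dom (ν : Measure X) (φ : X → ℂ) (β : X → ℝ≥0∞) (hβm : Measurable β)
    (hmeas : AEStronglyMeasurable φ ν) (g : X → ℝ) (hg : Integrable g ν) (hdom : ∀ u, (β u).toReal * ‖φ u‖ ≤ g u) :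
    Integrable (fun u => (β u).toReal • φ u) ν := by
  refine hg.mono' (hβm.ennreal_toReal.aestronglyMeasurable.smul hmeas) (Eventually.of_forall fun u => ?_)
  rw [norm_smul, Real.norm_of_nonneg ENNReal.toReal_nonneg]
  exact hdom u

/-- the (β0-hol) letters give integrability: from `hmeas` (a.e.-strong measurability of `u ↦ f s (a u)`, `s ∈ U`) and the local majorant `hdom` of
★ `K2LiuMiddleInnerSectionHolomorphic.differentiableOn_integral_toReal_smul_family`, `u ↦ (β u).toReal • f s (a u)` is integrable for every `s ∈ U`. [folklore] -/
theorem integrable_toReal_smul_of_dom_family (ν : Measure X) {U : Set ℂ} (f : ℂ → H → ℂ) (a : X → H) (β : X → ℝ≥0∞)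
    (hβm : Measurable β) (hmeas : ∀ s ∈ U, AEStronglyMeasurable (fun u => f s (a u)) ν)
    (hdom : ∀ z ∈ U, ∃ R > (0 : ℝ), ball z R ⊆ U ∧ ∃ g : X → ℝ, Integrable g ν ∧ ∀ u, ∀ s ∈ ball z R, (β u).toReal * ‖f s (a u)‖ ≤ g u) :
    ∀ s ∈ U, Integrable (fun u => (β u).toReal • f s (a u)) ν := by
  intro s hs
  obtain ⟨R, hR, -, g, hg, hgd⟩ := hdom s hs
  exact integrable_toReal_smul_of_dom ν (fun u => f s (a u)) β hβm (hmeas s hs) g hg fun u => hgd u s (mem_ball_self hR)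

end Integrable

variable {L : Type} [Field L] [NumberField L] [IsCMField L]
variable {N M n : ℕ} {e : Fin N × Fin M ≃ Fin n}
  {dV : Fin N → L} {hdV : ∀ i, IsCMField.complexConj L (dV i) = dV i}
  {dW : Fin M → L} {hdW : ∀ i, IsCMField.complexConj L (dW i) = dW i}

/-- **THE FLAT DEFORMATION OF THE `K_H`-TYPE EXPANSION.**  For a STANDARD family `f` (★ `IsStandardSectionFamily 𝒦 χ f`) and any `s₀`: with the basis of translates
`R(k_j) f_{s₀}` (`k_j ∈ K_H = 𝒦.K`) and the global matrix coefficients `c j l h = Σ_x w_j(x) · f_{s₀}(x·h·k_l)` of `f_{s₀}` (§1), for EVERY `s`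
`f_s(g·h) = Σ_j Σ_l a_l · c j l h · f_s(g·k_j)` for all `h ∈ K_H` and ALL `g ∈ H(𝔸)` — by the Iwasawa decomposition `g = p·k'` and the structure lemma
`f_s(p·k) = χ_s(p) · f_{s₀}(k)` (★ `IsStandardSectionFamily.apply_delta_mul`); no topology. [cite: Tan1999, §1] [cite: HarrisKudlaSweet1996, (1.17)] -/
theorem apply_mul_eq_sum_of_standard (𝒦 : IwasawaDatum L e dV hdV dW hdW) {χ : HeckeCharacter L}
    {f : ℂ → HA L e dV hdV dW hdW → ℂ} (hstd : IsStandardSectionFamily 𝒦 χ f) (s₀ : ℂ) :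
    ∃ (m : ℕ) (kb : Fin m → HA L e dV hdV dW hdW) (w : Fin m → (HA L e dV hdV dW hdW →₀ ℂ)) (a : Fin m → ℂ)
      (c : Fin m → Fin m → HA L e dV hdV dW hdW → ℂ),
      (∀ j, kb j ∈ 𝒦.K) ∧
      (∀ j l h, c j l h = (w j).sum fun x t => t * f s₀ (x * h * kb l)) ∧
      (∀ (j l : Fin m) (h k₁ : HA L e dV hdV dW hdW), k₁ ∈ 𝒦.K → c j l (h * k₁) = ∑ i, c i l k₁ * c j i h) ∧
      (∀ (s : ℂ) (h : HA L e dV hdV dW hdW), h ∈ 𝒦.K → ∀ g : HA L e dV hdV dW hdW,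
        f s (g * h) = ∑ j, ∑ l, (a l * c j l h) * f s (g * kb j)) := by
  obtain ⟨m, kb, w, a, c, hkb, hc, hlaw, hexp⟩ := exists_KType_coeff 𝒦.K (f s₀) (hstd.2.1 s₀)
  refine ⟨m, kb, w, a, c, hkb, hc, hlaw, fun s h hh g => ?_⟩
  obtain ⟨p, k', hp, hk', rfl⟩ := 𝒦.iwasawa g
  rw [mul_assoc, hstd.apply_delta_mul s s₀ hp (𝒦.K.mul_mem hk' hh), hexp h hh k', Finset.mul_sum]
  refine Finset.sum_congr rfl fun j _ => ?_
  rw [Finset.mul_sum]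
  refine Finset.sum_congr rfl fun l _ => ?_
  rw [mul_assoc p k' (kb j), hstd.apply_delta_mul s s₀ hp (𝒦.K.mul_mem hk' (hkb j))]
  ring

/-! ## §3 The finite `K_H`-type of the inner section — ★ I3's `c M G hcM hF hG` -/

/-- **A STANDARD SECTION FAMILY GIVES THE INNER SECTION A FINITE `K_H`-TYPE** (the by-value inputs of ★ I3 `K2LiuSiegelMiddleTermKTypes.exists_KTypes_package`).
For `f` STANDARD for `𝒦` (★ `IsStandardSectionFamily 𝒦 χ f`), a base point `s₀` with `f_{s₀}` continuous, and the inner section BY VALUE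
`F s y = ∫ (β u).toReal • f s (w₀·(a u·y)) dν` (integrable for `0 < re s`, `y ∈ 𝒦.K`: `hint`; `s ↦ F s k` continuous on `{0 < re}`: `hFc`), there are a finite
index type `ι`, coefficient functions `c_j : H(𝔸) → ℂ`, `M_{jl} : H(𝔸) → ℂ` and scalar families `G_j` with: the matrix-coefficient law
`c_j(h·k₁) = Σ_l M_{jl}(k₁) · c_l(h)` for ALL `h ∈ H(𝔸)`, `k₁ ∈ 𝒦.K`; `F s h = Σ_j c_j(h) · G_j(s)` for `0 < re s`, `h ∈ 𝒦.K`; `G_j` continuous on `{0 < re}`;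
`c_j` continuous on `H(𝔸)`; `c_j`, `M_{jl}` bounded on `𝒦.K`; and the LEVEL `c_j(h·u) = c_j(h)` for `u` in any subgroup `U` normalised by `𝒦.K` under which `f_{s₀}` is
right-invariant.  (`ι = Fin m × Fin m`; `c (j,l) h = ℓ_j(R(h)R(k_l)f_{s₀})`, `M (j,l) (j',i) k₁ = [j' = j] · c (i,l) k₁`, `G (j,l) s = a_l · F s k_j`, `a_l = ℓ_l(f_{s₀})`.)
[cite: MoeglinWaldspurger1995, II.1.7, IV.1.9] [cite: Tan1999, §1] [cite: HarrisKudlaSweet1996, (1.15)–(1.17)] [cite: BorelJacquet1979, §4.1] -/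
theorem exists_KHType_of_standard (𝒦 : IwasawaDatum L e dV hdV dW hdW) {χ : HeckeCharacter L}
    {f : ℂ → HA L e dV hdV dW hdW → ℂ} (hstd : IsStandardSectionFamily 𝒦 χ f) (s₀ : ℂ) (hfc : Continuous (f s₀))
    {X : Type*} [MeasurableSpace X] (ν : Measure X) (β : X → ℝ≥0∞) (w₀ : HA L e dV hdV dW hdW) (a : X → HA L e dV hdV dW hdW)
    (F : ℂ → HA L e dV hdV dW hdW → ℂ) (hF : ∀ s y, F s y = ∫ u, (β u).toReal • f s (w₀ * (a u * y)) ∂ν)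
    (hint : ∀ s : ℂ, 0 < s.re → ∀ k : HA L e dV hdV dW hdW, k ∈ 𝒦.K → Integrable (fun u => (β u).toReal • f s (w₀ * (a u * k))) ν)
    (hFc : ∀ k : HA L e dV hdV dW hdW, k ∈ 𝒦.K → ContinuousOn (fun s => F s k) {s : ℂ | 0 < s.re})
    (U : Subgroup (HA L e dV hdV dW hdW)) (hUK : ∀ k ∈ 𝒦.K, ∀ u ∈ U, k⁻¹ * u * k ∈ U)
    (hfU : ∀ (g : HA L e dV hdV dW hdW), ∀ u ∈ U, f s₀ (g * u) = f s₀ g) :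
    ∃ (ι : Type) (_ : Fintype ι) (c : ι → HA L e dV hdV dW hdW → ℂ) (Mc : ι → ι → HA L e dV hdV dW hdW → ℂ) (G : ι → ℂ → ℂ),
      (∀ (j : ι) (h k₁ : HA L e dV hdV dW hdW), k₁ ∈ 𝒦.K → c j (h * k₁) = ∑ l, Mc j l k₁ * c l h) ∧
      (∀ s : ℂ, 0 < s.re → ∀ h ∈ 𝒦.K, F s h = ∑ j, c j h * G j s) ∧
      (∀ j, ContinuousOn (G j) {s : ℂ | 0 < s.re}) ∧
      (∀ j, Continuous (c j)) ∧
      (∃ Cc : ℝ, ∀ j, ∀ h ∈ 𝒦.K, ‖c j h‖ ≤ Cc) ∧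
      (∃ CM : ℝ, ∀ j l, ∀ k ∈ 𝒦.K, ‖Mc j l k‖ ≤ CM) ∧
      (∀ (j : ι) (h : HA L e dV hdV dW hdW), ∀ u ∈ U, c j (h * u) = c j h) := by
  classical
  obtain ⟨m, kb, w, cf, c, hkb, hc, hlaw, hexp⟩ := apply_mul_eq_sum_of_standard 𝒦 hstd s₀
  -- continuity of the generalised matrix coefficients on `H(𝔸)`
  have hcont : ∀ j l, Continuous (c j l) := by
    intro j l
    have hEq : c j l = fun h => (w j).sum fun x t => t * f s₀ (x * h * kb l) := funext (hc j l)
    rw [hEq]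
    simp only [Finsupp.sum]
    exact continuous_finsetSum _ fun x _ =>
      continuous_const.mul (hfc.comp ((continuous_const.mul continuous_id).mul continuous_const))
  -- a uniform sup bound on the compact `𝒦.K`
  have hbd : ∃ C : ℝ, 0 ≤ C ∧ ∀ j l, ∀ h ∈ 𝒦.K, ‖c j l h‖ ≤ C := by
    have hB : ∀ j l, ∃ C, ∀ h ∈ 𝒦.K, ‖c j l h‖ ≤ C := fun j l =>
      𝒦.isCompact_K.exists_bound_of_continuousOn (hcont j l).continuousOn
    choose C hC using hB
    refine ⟨∑ j, ∑ l, max (C j l) 0, Finset.sum_nonneg fun j _ => Finset.sum_nonneg fun l _ => le_max_right _ _, fun j l h hh => ?_⟩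
    calc ‖c j l h‖ ≤ max (C j l) 0 := (hC j l h hh).trans (le_max_left _ _)
      _ ≤ ∑ l', max (C j l') 0 := Finset.single_le_sum (fun l' _ => le_max_right _ _) (Finset.mem_univ l)
      _ ≤ ∑ j', ∑ l', max (C j' l') 0 := Finset.single_le_sum (fun j' _ => Finset.sum_nonneg fun l' _ => le_max_right _ _) (Finset.mem_univ j)
  obtain ⟨C, hC0, hC⟩ := hbd
  refine ⟨Fin m × Fin m, inferInstance, fun p h => c p.1 p.2 h, fun p q k₁ => if q.1 = p.1 then c q.2 p.2 k₁ else 0,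
    fun p s => cf p.2 * F s (kb p.1), ?_, ?_, ?_, ?_, ⟨C, fun p h hh => hC p.1 p.2 h hh⟩, ⟨C, fun p q k hk => ?_⟩, ?_⟩
  · -- hcM
    intro p h k₁ hk₁
    show c p.1 p.2 (h * k₁) = ∑ q : Fin m × Fin m, (if q.1 = p.1 then c q.2 p.2 k₁ else 0) * c q.1 q.2 h
    rw [hlaw p.1 p.2 h k₁ hk₁, Fintype.sum_prod_type]
    dsimp only
    rw [Finset.sum_comm]
    refine Finset.sum_congr rfl fun i _ => ?_
    simp only [ite_mul, zero_mul, Finset.sum_ite_eq', Finset.mem_univ, if_true]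
  · -- hF
    intro s hs h hh
    have hint' : ∀ j, Integrable (fun u => (β u).toReal • f s (w₀ * (a u * kb j))) ν := fun j => hint s hs (kb j) (hkb j)
    show F s h = ∑ p : Fin m × Fin m, c p.1 p.2 h * (cf p.2 * F s (kb p.1))
    rw [hF s h, Fintype.sum_prod_type]
    dsimp only
    have hI : ∀ u, (β u).toReal • f s (w₀ * (a u * h)) = ∑ j, ∑ l, (cf l * c j l h) * ((β u).toReal • f s (w₀ * (a u * kb j))) := by
      intro u
      rw [← mul_assoc, hexp s h hh (w₀ * a u), Finset.smul_sum]
      refine Finset.sum_congr rfl fun j _ => ?_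
      rw [Finset.smul_sum]
      refine Finset.sum_congr rfl fun l _ => ?_
      rw [mul_smul_comm, mul_assoc w₀ (a u) (kb j)]
    simp_rw [hI]
    rw [integral_finsetSum _ fun j _ => integrable_finsetSum _ fun l _ => (hint' j).const_mul _]
    refine Finset.sum_congr rfl fun j _ => ?_
    rw [integral_finsetSum _ fun l _ => (hint' j).const_mul _]
    refine Finset.sum_congr rfl fun l _ => ?_
    rw [integral_const_mul, hF s (kb j)]
    ring
  · -- hG
    intro p
    exact continuousOn_const.mul (hFc (kb p.1) (hkb p.1))
  · -- continuity of `c`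
    intro p
    exact hcont p.1 p.2
  · -- bound of `M`
    show ‖(if q.1 = p.1 then c q.2 p.2 k else 0)‖ ≤ C
    split_ifs
    · exact hC q.2 p.2 k hk
    · rwa [norm_zero]
  · -- the level
    intro p h u hu
    show c p.1 p.2 (h * u) = c p.1 p.2 h
    rw [hc, hc]
    refine Finsupp.sum_congr fun x _ => ?_
    have hconj : (kb p.2)⁻¹ * u * kb p.2 ∈ U := hUK (kb p.2) (hkb p.2) u hu
    have hEq : x * (h * u) * kb p.2 = x * h * kb p.2 * ((kb p.2)⁻¹ * u * kb p.2) := by group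
    rw [hEq, hfU _ _ hconj]

end Summit.HodgeConjecture.HodgeConjecture.Cruxes.HLiu418.K2LiuSiegelMiddleTermInnerKTypeOfStandard

end
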